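import Summits.HodgeConjecture.HodgeConjecture.Theorems.F0P3cCMBorelIwahoriDatumU2Inst          -- ★ (T1₂) `exists_cmIwahoriDatum₂` (the CM Iwahori datum of `B₂ ≤ U(Φ₂)(L⁺_v)` along a ray)
import Summits.HodgeConjecture.HodgeConjecture.Theorems.F0P3cStCharTSA2Ray                       -- ★ `exists_torus_coe_localNonsplitEquiv_eq_diagonal_two` (the ray `d(β, (σ_w β)⁻¹)` in `T₂(L⁺_v)`)
import Summits.HodgeConjecture.HodgeConjecture.Theorems.F0P3cU2PrincipalSeriesOpenCellTorusChar    -- ★ `map_conj_cmBorel_two_eq_unitModulusChar_smul` (the Jacobian on `N₂`), `exists_skew_unit_localRing`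
import Summits.HodgeConjecture.HodgeConjecture.Theorems.F0P3bCentralCharacterUnitaryNonsplit      -- ★ G3 `exists_centralChar_norm_eq_one_of_nonsplit` (any `N`)
import Summits.HodgeConjecture.HodgeConjecture.Theorems.F0P3KeysCaseTwoOfStubs                   -- ★ `hasJacquetExponent_of_equiv_twist_trivial` (generic §1)
import Literature.NumberTheory.Automorphic.UnitaryTwoCartanAnyInvolution                          -- ★ `exists_cartan_of_involution_two` (Cartan decomposition of `U(σ, Φ₂)(K)` along `d(ϖ, (σϖ)⁻¹)`)
import Literature.NumberTheory.Automorphic.IwahoriStructureTransport                              -- ★ `StructureTransport.comap_cartan`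
import Literature.NumberTheory.Automorphic.CasselmanCriterionRankOne                              -- ★ `Representation.isSquareIntegrableModCenter_of_forall_norm_exponent_lt_one`
import Literature.NumberTheory.Automorphic.DoubleCosetShellVolumeBound                            -- ★ `DoubleCosetIndex.measure_image_doubleCoset_pow_le_ofReal` (upper shell bound)
import Literature.NumberTheory.Automorphic.DoubleCosetShellVolumeLowerBound                       -- ★ `norm_rootDeltaChar_sq_mul_modularCharacter_inv`
import Literature.NumberTheory.Automorphic.UnitaryGroupLineBorelModulus                           -- ★ `LineRing.modularCharacter_borelU_torus_two` (`Δ_{B₂}(diag d) = ‖d₀‖`)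
import Literature.NumberTheory.Automorphic.CMXiTorusCharSplitTorusDecay                           -- ★ `unitModulusChar_lt_one_of_forall_v_lt_one`
import Literature.NumberTheory.Automorphic.JacquetExponentUnique                                  -- ★ G5 `HasJacquetExponent.eq_of_equiv_twist_trivial`
import Literature.NumberTheory.Rogawski1990.U3PrincipalSeriesReducibility                        -- ★ `IrrClass.IsSquareIntegrable`, `isSquareIntegrable_mk`
import HarnessLib

/-!
# R90-TF ∕ S10 — CASSELMAN'S CRITERION «⇐» FOR `U(Φ₂)(L⁺_v) ≅ U(1,1)` AT A NON-SPLIT PLACE, CLASS LEVEL: an admissible irreducible class whose normalised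
# Jacquet module is ONE character `θ` decaying on the contracting torus (`‖θ(t)‖ < 1` whenever `‖t₀₀‖ < 1`) is square-integrable modulo the centre
# (`Theorems/R90S10U2SquareIntegrableOfJacquetDecay.lean`; ns `Summit.HodgeConjecture.HodgeConjecture.R90.S10`; lane `--supports stmt-HodgeConjecture-24833 --as helper`)

Cell `pub/hodgecm-mathlib`, R90-TF SLAB section S10, seat R90-C138-p04 (g0): PHASE 2 of card A1′ (DEAL-S10-WAVE1 card 1 «`St_H(ξ)|_{U(Φ₂)}` square-integrable mod centre»,
routed to p04 by DEAL #3 (g2)), brick (A) = the `N = 2` twin of ★ `F0P3U3SquareIntegrableExponentsHolds.perPlace_bwd` ∕ ★ `F0P3KeysCaseTwoOfStubs.isSquareIntegrable_iff_decays`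
(«⇐» half only).  THEOREM ONLY — sorry-free, no `def`, no instance, no notation, no named fact; ★-only imports.

THE MATHEMATICS ([Casselman1995, Thm. 4.4.6 p. 45]; [Rogawski1990, §12.2 p. 173]).  `G₂ = U(Φ₂)(L⁺_v)` at a finite place `v` of `L⁺` NON-SPLIT in the CM field `L`
(`w ∣ v` unique, `L_w ∕ L⁺_v` quadratic — ramified and residue characteristic `2` included), `B₂ = T₂N₂` its upper-triangular Borel (★ `cmBorelTriple L 2 v`),
`T₂ = {d(α, (σ_w α)⁻¹)}`.  Let `π` be an admissible irreducible smooth representation of `G₂` whose normalised Jacquet module `r_{B₂}(π)` is the character `θ` of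
`T₂`, and suppose `‖θ(t)‖ < 1` for every `t ∈ T₂` with `‖t₀₀‖ < 1`.  Then `π` is square-integrable modulo the centre for EVERY Haar measure on `G₂ ⧸ Z`:
(1) `π` has a unitary central character (the centre `Z(G₂) ≅ E¹_w` is compact at a non-split place, ★ G3 `exists_centralChar_norm_eq_one_of_nonsplit`);
(2) along the uniformiser ray `a ∈ T₂`, `e a = d(ϖ, (σ_w ϖ)⁻¹)` (★ «A2-RAY»), the CM Iwahori datum `𝓘` of `B₂` with `K₀ = U(Φ₂)(𝒪_v) ⊇ Z` (★ (T1₂) `exists_cmIwahoriDatum₂`: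
levels normalised by `K₀`, `a` dominant, `⋃ₘ a⁻ᵐ(K_n ∩ N)aᵐ = N`, unique `N`-components) and the Cartan decomposition `G₂ = ⋃ₘ K₀ aᵐ K₀ Z` (★ `exists_cartan_of_involution_two`
in the one-place model, pulled back by ★ `StructureTransport.comap_cartan`); (3) the shell volumes `μZ(K₀ aᵐ K₀ Z ∕ Z) ≤ [K₀ : K] μZ(K₀Z∕Z) ‖ϖ‖_w^{-m}` (★
`DoubleCosetIndex.measure_image_doubleCoset_pow_le_ofReal` with the Jacobian `d(n ↦ aᵐ n a⁻ᵐ) = ‖ϖ‖^{-m} dn` on `N₂`, ★ `map_conj_cmBorel_two_eq_unitModulusChar_smul`) and the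
modulus identity `‖δ_{B₂}^{1/2}(a)‖² · ‖ϖ‖⁻¹ = 1` (★ `norm_rootDeltaChar_sq_mul_modularCharacter_inv`, ★ `modularCharacter_borelU_torus_two`: `Δ_{B₂}(a) = ‖a₀₀‖ = ‖ϖ‖`);
(4) every exponent of `π` is `θ` (★ G5) and `‖θ(a)‖ < 1` since `‖a₀₀‖ = ‖ϖ‖_w < 1` (★ `unitModulusChar_lt_one_of_forall_v_lt_one`); (5) ★
`Representation.isSquareIntegrableModCenter_of_forall_norm_exponent_lt_one` concludes.  CONSUMER: brick (C) `R90S10U2SteinbergSquareIntegrable` (the named input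
(St₂-L²) of ★-cand `R90S10SteinbergFactorOfLengthTwoLabels.steinbergFactorSt_of_sqInt`) at `θ = χ₂ = (η̃_v‖·‖^{1/2}, ψ_v)`, the Jacquet character of `St(ξ₂)`.
HONEST LABEL: helper, pays no socket by itself; HC_CM is proved only modulo the 7 printed citations (2 remaining named inputs: hLiu418 = `stmt-HodgeConjecture-24832`,
h413 = `stmt-HodgeConjecture-24833`) until rung 0 closes; REL ≠ ★ ≠ BUILT; count-neutral.

## References
* [Casselman1995] W. Casselman, *Introduction to the theory of admissible representations of `p`-adic reductive groups* (draft 1 May 1995), Prop. 1.4.4 p. 14, §1.5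
  Lemma 1.5.1 p. 16, Thm. 4.4.6 p. 45.
* [Rogawski1990] J. D. Rogawski, *Automorphic Representations of Unitary Groups in Three Variables*, Ann. of Math. Stud. 123 (1990), §1.10 p. 9; §12.1 p. 171; §12.2 p. 173.
* [PlatonovRapinchuk1994] V. Platonov, A. Rapinchuk, *Algebraic Groups and Number Theory* (1994), §5.1.
-/

set_option autoImplicit false
set_option linter.dupNamespace false

noncomputable section

open MeasureTheory Measure NumberField IsDedekindDomain
open Literature.NumberTheory.Automorphic Literature.NumberTheory.Automorphic.UnitaryGroup
open scoped NNReal ENNReal Pointwise MatrixGroups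

namespace Summit.HodgeConjecture.HodgeConjecture.R90.S10

open Summit.HodgeConjecture.HodgeConjecture.Cruxes.H413

variable (L : Type) [Field L] [NumberField L] [IsCMField L] (v : HeightOneSpectrum (𝓞 ↥(maximalRealSubfield L)))

set_option synthInstance.maxHeartbeats 400000 in
set_option maxHeartbeats 1600000 in  -- the one-place model vs the CM carrier (defeq unfoldings of `cmLocalForm`, as ★ (T1₂) ∕ ★ `perPlace_bwd`)
/-- **CASSELMAN «⇐» ON `U(Φ₂)(L⁺_v)`, CLASS LEVEL.**  At a NON-SPLIT finite place `v`, for every Haar measure `μZ` on `U(Φ₂)(L⁺_v) ⧸ Z`: an ADMISSIBLE irreducible class `c`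
some representative of which has normalised Jacquet module `r_{B₂} ≅ θ` (one character of `T₂(L⁺_v)`), with `‖θ(t)‖ < 1` for every `t ∈ T₂` with `‖t₀₀‖ < 1`, is
square-integrable modulo the centre (★ `IrrClass.IsSquareIntegrable μZ`).  Proof: module docstring (1)–(5). [cite: Casselman1995, Thm. 4.4.6 p. 45, Prop. 1.4.4 p. 14, Lemma 1.5.1 p. 16]
[cite: Rogawski1990, §12.2 p. 173; §1.10 p. 9] -/
theorem isSquareIntegrable_of_jacquet_decays_two (hns : ∀ w : PlacesOver L v, IsCMField.complexConj L • w.1 = w.1)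
    [MeasurableSpace (↥(unitaryGroupOfForm (conjLocal L (IsCMField.complexConj L) v) (cmLocalForm L 2 v)) ⧸
      Subgroup.center ↥(unitaryGroupOfForm (conjLocal L (IsCMField.complexConj L) v) (cmLocalForm L 2 v)))]
    [BorelSpace (↥(unitaryGroupOfForm (conjLocal L (IsCMField.complexConj L) v) (cmLocalForm L 2 v)) ⧸
      Subgroup.center ↥(unitaryGroupOfForm (conjLocal L (IsCMField.complexConj L) v) (cmLocalForm L 2 v)))]
    (μZ : Measure (↥(unitaryGroupOfForm (conjLocal L (IsCMField.complexConj L) v) (cmLocalForm L 2 v)) ⧸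
      Subgroup.center ↥(unitaryGroupOfForm (conjLocal L (IsCMField.complexConj L) v) (cmLocalForm L 2 v)))) [μZ.IsHaarMeasure]
    (c : IrrClass ↥(unitaryGroupOfForm (conjLocal L (IsCMField.complexConj L) v) (cmLocalForm L 2 v)))
    (θ : ↥(torusU (conjLocal L (IsCMField.complexConj L) v) (cmLocalForm L 2 v)) →* ℂˣ) (hc : c.IsAdmissible)
    (hθ : haveI := locallyCompactSpace_cmBorelU L 2 v
      ∃ r : SmoothIrrep ↥(unitaryGroupOfForm (conjLocal L (IsCMField.complexConj L) v) (cmLocalForm L 2 v)), IrrClass.mk r = c ∧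
        Nonempty ((r.ρ.normalizedJacquet (cmBorelTriple L 2 v)).Equiv
          ((Representation.trivial ℂ ↥(torusU (conjLocal L (IsCMField.complexConj L) v) (cmLocalForm L 2 v)) ℂ).twist θ)))
    (hdec : ∀ t : ↥(torusU (conjLocal L (IsCMField.complexConj L) v) (cmLocalForm L 2 v)),
      unitModulusChar (LocalRing L v) (torusEntry (conjLocal L (IsCMField.complexConj L) v) (cmLocalForm L 2 v) 0 t) < 1 → ‖((θ t : ℂˣ) : ℂ)‖ < 1) :
    c.IsSquareIntegrable μZ := by
  obtain ⟨r, rfl, ⟨e⟩⟩ := hθ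
  haveI := locallyCompactSpace_cmBorelU L 2 v
  haveI : LocallyCompactSpace ↥(unitaryGroupOfForm (conjLocal L (IsCMField.complexConj L) v) (cmLocalForm L 2 v)) :=
    locallyCompactSpace_local (IsCMField.complexConj L) 2 _ v
  haveI : SecondCountableTopology ↥(unitaryGroupOfForm (conjLocal L (IsCMField.complexConj L) v) (cmLocalForm L 2 v)) :=
    secondCountableTopology_local (IsCMField.complexConj L) 2 _ v
  -- (1) admissibility and the unitary central character
  have hadm : r.ρ.IsAdmissible := (IrrClass.isAdmissible_mk r).1 hc
  obtain ⟨ω, hω, hω1⟩ :=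
    @F0P3bCentralCharacterUnitaryNonsplit.exists_centralChar_norm_eq_one_of_nonsplit L _ _ _ 2 v hns r.V _ _ r.ρ r.instIsIrreducible hadm
  -- (2) the place `w`, a uniformiser `ϖ`, the ray `a` with `e a = d(ϖ, (σ_w ϖ)⁻¹)`
  obtain ⟨w⟩ := (inferInstance : Nonempty (PlacesOver L v))
  have hw : IsCMField.complexConj L • w.1 = w.1 := hns w
  haveI : Subsingleton (PlacesOver L v) :=
    PlacesOver.subsingleton_of_smul_eq (IsCMField.complexConj L) (IsCMField.complexConj_ne_one L) w hw
  obtain ⟨ϖL, hϖL⟩ := w.1.valuation_exists_uniformizer L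
  have hϖ : Valued.v ((ϖL : L) : w.1.adicCompletion L) = WithZero.exp (-1 : ℤ) := by
    rw [HeightOneSpectrum.valuedAdicCompletion_eq_valuation', hϖL]
  have hϖ0 : ((ϖL : L) : w.1.adicCompletion L) ≠ 0 := by
    intro h
    rw [h, map_zero] at hϖ
    exact WithZero.exp_ne_zero hϖ.symm
  have hϖ1 : Valued.v ((ϖL : L) : w.1.adicCompletion L) < 1 := by
    rw [hϖ, ← WithZero.exp_zero]
    exact WithZero.exp_lt_exp.2 (by norm_num)
  obtain ⟨a, ha⟩ := F0P3cStCharTSA2Ray.exists_torus_coe_localNonsplitEquiv_eq_diagonal_two L v w hw hϖ0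
  -- (T1₂) the CM Iwahori datum along `a`
  obtain ⟨𝓘, K₀, ha𝓘, hK₀c, hK₀o, hZK₀, hKle, hKK₀, haN, haNbar, hexh, hinj, hK₀iff, -, -⟩ :=
    F0P3cCMBorelIwahoriDatumU2.exists_cmIwahoriDatum₂ L v w hw
      (a : ↥(unitaryGroupOfForm (conjLocal L (IsCMField.complexConj L) v) (cmLocalForm L 2 v))) hϖ0 hϖ1 ha
  have hsub : (⟨𝓘.a, 𝓘.a_mem⟩ : ↥(cmBorelTriple L 2 v).M) = a := Subtype.ext ha𝓘
  -- the Cartan decomposition `G₂ = ⋃ₘ K₀ aᵐ K₀ Z` through the one-place model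
  have hJw := F0P3cCMLocalNonsplitBorelTransportU2.placeForm_antidiagTwo_eq L v w
  have hσσ : ∀ x, galAdicCompletionMap (L := L) (IsCMField.complexConj L) hw
      (galAdicCompletionMap (L := L) (IsCMField.complexConj L) hw x) = x :=
    galAdicCompletionMap_galAdicCompletionMap_of_smul_eq (IsCMField.complexConj L) w (IsCMField.complexConj_ne_one L) hw
  have hσv : ∀ x, Valued.v ((galAdicCompletionMap (L := L) (IsCMField.complexConj L) hw) x) = Valued.v x :=
    fun x => valued_galAdicCompletionMap (L := L) (IsCMField.complexConj L) hw x
  have hcart := StructureTransport.comap_cartan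
    (localNonsplitEquiv (IsCMField.complexConj L) (Matrix.of fun i j : Fin 2 => if i.val + j.val + 1 = 2 then (1 : L) else 0)
      (IsCMField.complexConj_ne_one L) w hw)
    (K₀' := (glInt 2 (w.1.adicCompletion L)).comap
      (unitaryGroupOfForm (galAdicCompletionMap (L := L) (IsCMField.complexConj L) hw)
        (placeForm (Matrix.of fun i j : Fin 2 => if i.val + j.val + 1 = 2 then (1 : L) else 0) w.1)).subtype)
    (fun g => Two.exists_cartan_of_involution_two (galAdicCompletionMap (L := L) (IsCMField.complexConj L) hw) hJw hσσ hσv hϖ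
      ((localNonsplitEquiv (IsCMField.complexConj L) (Matrix.of fun i j : Fin 2 => if i.val + j.val + 1 = 2 then (1 : L) else 0)
        (IsCMField.complexConj_ne_one L) w hw)
        (a : ↥(unitaryGroupOfForm (conjLocal L (IsCMField.complexConj L) v) (cmLocalForm L 2 v)))) ha g)
  have hcartan : ∀ g : ↥(unitaryGroupOfForm (conjLocal L (IsCMField.complexConj L) v) (cmLocalForm L 2 v)),
      ∃ k₁ ∈ K₀, ∃ k₂ ∈ K₀, ∃ m : ℕ, ∃ z ∈ Subgroup.center ↥(unitaryGroupOfForm (conjLocal L (IsCMField.complexConj L) v) (cmLocalForm L 2 v)),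
        g = k₁ * 𝓘.a ^ m * k₂ * z := by
    intro g
    obtain ⟨k₁, hk₁, k₂, hk₂, m, z, hz, hg⟩ := hcart g
    refine ⟨k₁, (hK₀iff k₁).2 (Subgroup.mem_comap.1 (Subgroup.mem_comap.1 hk₁)), k₂, (hK₀iff k₂).2 (Subgroup.mem_comap.1 (Subgroup.mem_comap.1 hk₂)),
      m, z, hz, ?_⟩
    rw [ContinuousMulEquiv.symm_apply_apply] at hg
    rw [ha𝓘]
    exact hg
  -- (3) the shell volumes: closed `N₂`, its Haar measure and the Jacobian of `n ↦ aᵐ n a⁻ᵐ`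
  have hNcl : IsClosed (((cmBorelTriple L 2 v).N : Subgroup ↥(unitaryGroupOfForm (conjLocal L (IsCMField.complexConj L) v) (cmLocalForm L 2 v))) :
      Set ↥(unitaryGroupOfForm (conjLocal L (IsCMField.complexConj L) v) (cmLocalForm L 2 v))) :=
    (isClosed_upperUnitriangular (n := 2) (R := LocalRing L v)).preimage continuous_subtype_val
  haveI : LocallyCompactSpace ↥(cmBorelTriple L 2 v).N := hNcl.isClosedEmbedding_subtypeVal.locallyCompactSpace
  haveI : SecondCountableTopology ↥(cmBorelTriple L 2 v).N := TopologicalSpace.Subtype.secondCountableTopology _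
  letI : MeasurableSpace ↥(cmBorelTriple L 2 v).N := borel _
  haveI : BorelSpace ↥(cmBorelTriple L 2 v).N := ⟨rfl⟩
  letI : MeasurableSpace ↥(unitaryGroupOfForm (conjLocal L (IsCMField.complexConj L) v) (cmLocalForm L 2 v)) := borel _
  haveI : BorelSpace ↥(unitaryGroupOfForm (conjLocal L (IsCMField.complexConj L) v) (cmLocalForm L 2 v)) := ⟨rfl⟩
  -- the torus ray as an element of `T₂` and its powers
  set aT : ↥(torusU (conjLocal L (IsCMField.complexConj L) v) (cmLocalForm L 2 v)) := ⟨𝓘.a, 𝓘.a_mem⟩ with haT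
  have hconjN : ∀ (t : ↥(torusU (conjLocal L (IsCMField.complexConj L) v) (cmLocalForm L 2 v))) (u : ↥(cmBorelTriple L 2 v).N),
      (t : ↥(unitaryGroupOfForm (conjLocal L (IsCMField.complexConj L) v) (cmLocalForm L 2 v)))⁻¹ * u * t ∈ (cmBorelTriple L 2 v).N :=
    fun t u => (LineRing.torus_inv_conj_mem_unipotentU_iff (conjLocal L (IsCMField.complexConj L) v) (cmLocalForm L 2 v) t.2 _).2 u.2
  let ψ : ℕ → ↥(cmBorelTriple L 2 v).N → ↥(cmBorelTriple L 2 v).N := fun m u =>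
    ⟨((((aT ^ m)⁻¹ : ↥(torusU (conjLocal L (IsCMField.complexConj L) v) (cmLocalForm L 2 v))) :
        ↥(unitaryGroupOfForm (conjLocal L (IsCMField.complexConj L) v) (cmLocalForm L 2 v))))⁻¹ *
      (u : ↥(unitaryGroupOfForm (conjLocal L (IsCMField.complexConj L) v) (cmLocalForm L 2 v))) *
      (((aT ^ m)⁻¹ : ↥(torusU (conjLocal L (IsCMField.complexConj L) v) (cmLocalForm L 2 v))) :
        ↥(unitaryGroupOfForm (conjLocal L (IsCMField.complexConj L) v) (cmLocalForm L 2 v))), hconjN _ u⟩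
  have hψ : ∀ (m : ℕ) (n : ↥(cmBorelTriple L 2 v).N),
      ((ψ m n : ↥(cmBorelTriple L 2 v).N) : ↥(unitaryGroupOfForm (conjLocal L (IsCMField.complexConj L) v) (cmLocalForm L 2 v))) =
        𝓘.a ^ m * n * (𝓘.a ^ m)⁻¹ := by
    intro m n
    change ((((aT ^ m)⁻¹ : ↥(torusU (conjLocal L (IsCMField.complexConj L) v) (cmLocalForm L 2 v))) :
        ↥(unitaryGroupOfForm (conjLocal L (IsCMField.complexConj L) v) (cmLocalForm L 2 v))))⁻¹ *
      (n : ↥(unitaryGroupOfForm (conjLocal L (IsCMField.complexConj L) v) (cmLocalForm L 2 v))) *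
      (((aT ^ m)⁻¹ : ↥(torusU (conjLocal L (IsCMField.complexConj L) v) (cmLocalForm L 2 v))) :
        ↥(unitaryGroupOfForm (conjLocal L (IsCMField.complexConj L) v) (cmLocalForm L 2 v))) = _
    rw [Subgroup.coe_inv, inv_inv, Subgroup.coe_pow]
  have hμN : ∀ m : ℕ, (Measure.haar : Measure ↥(cmBorelTriple L 2 v).N).map (ψ m) =
      (((unitModulusChar (LocalRing L v) (torusEntry (conjLocal L (IsCMField.complexConj L) v) (cmLocalForm L 2 v) 0 aT))⁻¹ ^ m : ℝ≥0) : ℝ≥0∞) •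
        (Measure.haar : Measure ↥(cmBorelTriple L 2 v).N) := by
    intro m
    have h := F0P3cU2PrincipalSeriesOpenCellTorusChar.map_conj_cmBorel_two_eq_unitModulusChar_smul L v (aT ^ m)⁻¹
      (Measure.haar : Measure ↥(cmBorelTriple L 2 v).N)
    have hsc : unitModulusChar (LocalRing L v) (torusEntry (conjLocal L (IsCMField.complexConj L) v) (cmLocalForm L 2 v) 0 (aT ^ m)⁻¹) =
        (unitModulusChar (LocalRing L v) (torusEntry (conjLocal L (IsCMField.complexConj L) v) (cmLocalForm L 2 v) 0 aT))⁻¹ ^ m := by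
      rw [map_inv, map_pow, map_inv, map_pow, inv_pow]
    rw [hsc, ENNReal.smul_def] at h
    exact h
  have haM : ∀ x ∈ 𝓘.K 0 ⊓ (cmBorelTriple L 2 v).M, x * 𝓘.a = 𝓘.a * x := fun x hx => 𝓘.a_comm x (Subgroup.mem_inf.1 hx).2
  have haN_ : ∀ n ∈ (cmBorelTriple L 2 v).N, 𝓘.a⁻¹ * n * 𝓘.a ∈ (cmBorelTriple L 2 v).N := fun n hn => hconjN aT ⟨n, hn⟩
  have haN' : ∀ n ∈ (cmBorelTriple L 2 v).N, 𝓘.a * n * 𝓘.a⁻¹ ∈ (cmBorelTriple L 2 v).N := by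
    intro n hn
    have h := hconjN aT⁻¹ ⟨n, hn⟩
    rwa [Subgroup.coe_inv, inv_inv] at h
  have hvol := fun m : ℕ => DoubleCosetIndex.measure_image_doubleCoset_pow_le_ofReal hZK₀ hK₀o hK₀c (hKle 0) (𝓘.isOpen_K 0) (𝓘.isCompact_K 0)
    (𝓘.factorization 0) hinj haM (haN 0) (haNbar 0) haN_ haN' hNcl (Measure.haar : Measure ↥(cmBorelTriple L 2 v).N) ψ hψ hμN μZ m
  -- the modulus identity: `Δ_{B₂}(a) = ‖a₀₀‖`, so `‖δ^{1/2}(a)‖² · ‖a₀₀‖⁻¹ = 1`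
  obtain ⟨δ, hδ⟩ := F0P3cU2PrincipalSeriesOpenCellTorusChar.exists_skew_unit_localRing L v
  obtain ⟨d, hd⟩ := (mem_torusU_iff _).1 aT.2
  letI : MeasurableSpace (LocalRing L v) := borel _
  haveI : BorelSpace (LocalRing L v) := ⟨rfl⟩
  have hmod : (modularCharacter (⟨𝓘.a, (cmBorelTriple L 2 v).M_le 𝓘.a_mem⟩ : ↥(cmBorelTriple L 2 v).P) : ℝ≥0) =
      unitModulusChar (LocalRing L v) (torusEntry (conjLocal L (IsCMField.complexConj L) v) (cmLocalForm L 2 v) 0 aT) := by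
    rw [torusEntry_eq_of_glDiagonal_eq (conjLocal L (IsCMField.complexConj L) v) (cmLocalForm L 2 v) 0 aT d hd]
    exact LineRing.modularCharacter_borelU_torus_two (conjLocal L (IsCMField.complexConj L) v) (conjLocal_conjLocal_cm L v)
      (continuous_conjLocal L (IsCMField.complexConj L) v) (cmLocalForm_eq_over L 2 v) δ hδ aT hd
  have hδD : ‖((rootDeltaChar (cmBorelTriple L 2 v).P ⟨𝓘.a, (cmBorelTriple L 2 v).M_le 𝓘.a_mem⟩ : ℂˣ) : ℂ)‖ ^ 2 *
      ((unitModulusChar (LocalRing L v) (torusEntry (conjLocal L (IsCMField.complexConj L) v) (cmLocalForm L 2 v) 0 aT) : ℝ))⁻¹ = 1 := by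
    rw [← hmod]
    exact norm_rootDeltaChar_sq_mul_modularCharacter_inv _ _
  -- (4) the exponents: all equal to `θ`, and `‖θ(a)‖ < 1` since `‖a₀₀‖ = |ϖ|_w < 1`
  have ha00 : unitModulusChar (LocalRing L v) (torusEntry (conjLocal L (IsCMField.complexConj L) v) (cmLocalForm L 2 v) 0 aT) < 1 := by
    refine unitModulusChar_lt_one_of_forall_v_lt_one L v _ fun w' => ?_
    obtain rfl : w' = w := Subsingleton.elim _ _
    have h00 := congr_fun (congr_fun ha 0) 0
    rw [F0P3cCMLocalNonsplitBorelTransportU2.localNonsplitEquiv_apply_apply₂, Matrix.diagonal_apply_eq, Matrix.cons_val_zero] at h00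
    rw [hsub, coe_torusEntry]
    exact lt_of_eq_of_lt (congrArg Valued.v h00) hϖ1
  have hexp : ∀ χ' : ↥(cmBorelTriple L 2 v).M →* ℂˣ, r.ρ.HasJacquetExponent (cmBorelTriple L 2 v) χ' →
      ‖((χ' ⟨𝓘.a, 𝓘.a_mem⟩ : ℂˣ) : ℂ)‖ < 1 := by
    intro χ' hχ'
    rw [hχ'.eq_of_equiv_twist_trivial (cmBorelTriple L 2 v) e]
    exact hdec aT ha00
  -- (5) the criterion
  rw [IrrClass.isSquareIntegrable_mk_iff μZ r]
  exact Representation.isSquareIntegrableModCenter_of_forall_norm_exponent_lt_one μZ hadm ω hω hω1 (cmBorelTriple L 2 v) 𝓘 hNcl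
    (fun x y => torusU_mul_comm _ _ x y) K₀ hK₀c hK₀o hKK₀ haN haNbar hexh hcartan
    (C := ((𝓘.K 0).relIndex K₀ : ℝ) *
      μZ.real ((QuotientGroup.mk : _ → ↥(unitaryGroupOfForm (conjLocal L (IsCMField.complexConj L) v) (cmLocalForm L 2 v)) ⧸
        Subgroup.center ↥(unitaryGroupOfForm (conjLocal L (IsCMField.complexConj L) v) (cmLocalForm L 2 v))) '' (K₀ : Set _)))
    (D := ((unitModulusChar (LocalRing L v) (torusEntry (conjLocal L (IsCMField.complexConj L) v) (cmLocalForm L 2 v) 0 aT) : ℝ))⁻¹)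
    (mul_nonneg (Nat.cast_nonneg _) measureReal_nonneg) (inv_nonneg.2 (NNReal.coe_nonneg _))
    hvol hδD hexp

end Summit.HodgeConjecture.HodgeConjecture.R90.S10

end
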